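import Literature.MathematicalPhysics.QuantumFieldTheory.Federbush1986.PhaseCellIVGeomConstruction5
import Literature.MathematicalPhysics.QuantumFieldTheory.Federbush1986.CubeRadialProjection

/-!
# `Federbush1986.PhaseCellIVGeomConstruction6` — [Federbush1988PhaseCellIV] §11 **Geometric Construction 6** (11.12)–(11.13)
# p. 338–339 (the extension `ᵉφ′` of a homotopically non-trivial gauge `φ′ : ∂H → G` to `H − x₀`, smooth off the singular point
# `x₀` near the centre, with `|D^α ᵉφ′(x)| ≤ c_α max(d(x, ∂D)^{−(|α|−1)}, d(x, x₀)^{−(|α|−1)})·(L_r/d(x, x₀))·Λ₁(φ′)`) =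
# Theorem A.4 ON THE UNIT CUBE — PROVED for every uniformly smoothly retractable target, hence for every compact `C^∞`
# submanifold `M ⊂ R^t`, every compact matrix group (`U(N)`, `SU(N)`, `ρ(G)`) and the spheres, for every centering radius `δ < ½`

statement-level skeleton of published theorems with citation tags; proofs where landed; nothing here is a claim about the Yang–Mills mass gap

CITATION HEADER.  P. Federbush, *A phase cell approach to Yang–Mills theory. IV. The choice of variables*, Commun. Math.
Phys. **114** (1988) 317–343 [Federbush1988PhaseCellIV], §11 («Gauge Interpolation – A Herculean Task») p. 338–339 and Appendix A part D, Theorem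
A.4 with its proof (A.37)–(A.38) p. 343, «Caution» p. 339 (renders f4-p022/f4-p023/f4-p027 of unit `lit-balaban-r19`, read
as images).  Cell `lit-balaban`, Phase-2 proof seat **r19 gen 11** (F4 fold owner, `ROWS-F4.md`); SKELETON row **F4.Def§11**,
cell Geometric Construction 6 — decl `PhaseCellIVGauge.GeomConstruction6 k t M δ` (typed p314251, `PhaseCellIVGaugeInterpolation`
§5).  Inputs BY NAME: `DyadicSmoothing.CutoffSystem` + `CubeCutoffs.cubeSystem` (r19 g11: the cube smoothing engine of
Construction 5), `CubeRadialProjection` (r19 g11: `CubeRadial.proj`, `lipschitzOnWith_proj`, `proj_mem_cubeBoundary`,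
`proj_eq_self`), `PuncturedBallMaps` (p04 g7: `fold`, `exists_fold_bound`, `lipschitzWith_sInf`), `PhaseCellIVThmA4Retract`
(p262634: `norm_iteratedFDeriv_comp_fold_le` — the chain rule through the fold), `PhaseCellIVThmA3Retract` (p261759:
`norm_iteratedFDeriv_comp_le_of_scale`), `PhaseCellIVGeomConstruction5` (r19 g11, for the targets), Mathlib
`LipschitzOnWith.extend_finite_dimension`, `ContinuousLinearMap.iteratedFDerivWithin_comp_right`.

WHAT IS PRINTED (p. 338–339, verbatim).  «We finally consider `φ′(x)` defined on `∂H` of hypercube `H` where `φ′` is not a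
homotopically trivial map from `∂H` to `G`.  In this case we find an extension, discontinuous at one point `x₀`.  `x₀` is picked
as a point in `H` with the following property: *Centering Property.* With `H` level `r`, `d(x₀, c(H)) ≤ L_{r+1}` … *Geometric
Construction 6.* `ᵉφ′(x)` defined on `H − x₀`, as an extension of `φ′(x)` defined on `∂H`, satisfies a) `ᵉφ′(x) = φ′(x)`,
`x ∈ ∂H`, (11.12) b) `|D^α ᵉφ′(x)| ≤ c_α · Max(1/(d(x, ∂D))^{|α|−1}, 1/(d(x, x₀))^{|α|−1}) · (L_r/d(x, x₀)) · Λ₁(φ′)`. (11.13)»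
Appendix A part D proves this as Theorem A.4 for the unit BALL (A.34)–(A.36): «We define `d′ ∈ C^∞` … `½ d(x, ∂B ∪ x₀) ≤ d′(x)
≤ d(x, ∂B ∪ x₀)` (A.37) and follow the construction of subsect. C using `f_ε(x) = ∫ dy w^{εd′(x)}(x − y) f((y − x₀)/|y − x₀| +
x₀)` (A.38) instead of (A.30). … straightforward.»

WHAT THIS FILE PROVES.  `geomConstruction6_of_retract`: **for every `δ < ½`, `GeomConstruction6 k t M δ` — Theorem A.4 on
the unit `k`-cube with the singular point `x₀` any point within `δ` of the centre, capped as typed — holds for every `k` and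
every `M ⊆ R^t` admitting a uniform smooth neighbourhood retraction** (print's normal projection); `geomConstruction6_of_submanifold`:
hence for EVERY COMPACT `C^∞` SUBMANIFOLD `M ⊂ R^t`; `_of_isCompact_subgroup` / `_range_of_compact` / `_unitaryGroup` /
`_specialUnitaryGroup` / `_sphere`: print's targets `M = G`, hypothesis-free.  The constants `c_m = c_m(c₁, δ, k, M)` do not
depend on `x₀`; print's Centering Property gives `δ = L_{r+1}/L_r = 1/N ≤ ⅓ < ½` at unit scale.
PROOF = print's (A.37)–(A.38) transplanted to the cube, along p04's formalisation of Theorem A.4 (`thmA4_center_zero`): with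
`μ = ½ − δ ≤` every face distance of `x₀` and `ρ = μ/2`, the datum `φ′ : ∂H → M` is extended `0`-homogeneously about `x₀` by
the radial projection onto `∂H`, `g = φ′ ∘ π_{x₀}` (print's integrand of (A.38) with the sphere replaced by `∂H`; `M`-valued,
`= φ′` on `∂H`, Lipschitz with constant `C(k, δ)Λ₁(φ′)` on `{|y − x₀| ≥ ρ/2}`, `CubeRadialProjection`), extended to `ℝᵏ`
(McShane) and mollified by the cube engine of Construction 5: `u = f_ε(ḡ)`; the fold of p04 conjugated to `B(x₀, ρ)` (identity
for `|x − x₀| ≥ ¾ρ`, `x ↦ x₀ + (ρ/2)(x − x₀)/|x − x₀|` for `|x − x₀| ≤ ρ/2`) realises print's scale `εd′(x) ≍ ε·min(d(x, ∂D),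
|x − x₀|)` through the `0`-homogeneity of the datum; `ᵉφ′ := Pr_M ∘ u ∘ Fold`.  (11.12): on `∂H` the fold is the identity,
`u = ḡ = φ′`, `Pr_M = id` on `M`.  (11.13): away from `x₀` (`|x − x₀| > ¾ρ`) this is Construction 5 verbatim (bound
`c m(x)^{1−m}Λ₁ ≤ c√k · d(x, ∂D)^{1−m} |x − x₀|^{−1} Λ₁` as `|x − x₀| ≤ √k`); near `x₀` (`|x − x₀| ≤ ¾ρ`) the map is
`x ↦ Pr_M(u(x₀ + (ρ/2)·(x − x₀)/|x − x₀|))`-like, `0`-homogeneous, each derivative costing `|x − x₀|^{−1}` (p04's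
`norm_iteratedFDeriv_comp_fold_le` in the rescaled variable `z = (x − x₀)/ρ`, affine transport back) — giving
`c |x − x₀|^{−(m−1)} |x − x₀|^{−1} Λ₁`.  ONE construction with the least Lipschitz constant of `φ′` serves every admissible
`Λ₁ ≤ c₁` (p04's `lipschitzWith_sInf`).  The case `k = 0` (`H − x₀ = ∅`) is vacuous.

WHAT THIS MODULE PROVIDES (namespace `PhaseCellIVGauge`): def with body `Fold` (the conjugated fold); theorems
`norm_iteratedFDeriv_comp_affine_le`, `norm_inv_smul_sub`, `inv_smul_sub_ne_zero`, `Fold_eq_self`, `norm_Fold_sub`,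
`half_le_norm_Fold_sub`, `norm_Fold_sub_le`, `contDiffOn_Fold`, `face_dist_of_dist_center_le`, `norm_sub_le_sqrt_of_mem_unitCube`,
`le_norm_sub_of_mem_cubeBoundary`, **`geomConstruction6_of_retract`** (one long proof: elaborated under `maxHeartbeats 800000`),
**`geomConstruction6_of_submanifold`**, `geomConstruction6_of_isCompact_subgroup`, `geomConstruction6_range_of_compact`,
`geomConstruction6_unitaryGroup`, `geomConstruction6_specialUnitaryGroup`, `geomConstruction6_sphere`.  No `Prop`-valued
definition, no named fact; axioms standard.
-/

namespace Literature.MathematicalPhysics.QuantumFieldTheory.Federbush1986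

noncomputable section

open MeasureTheory Metric Set Filter Function
open scoped ContDiff Topology NNReal Nat

namespace PhaseCellIVGauge

open LipschitzMollifier (Euc)
open DyadicSmoothing CubeCutoffs CubeRadial PuncturedBall PhaseCellIVAppA PhaseCellIVAppA.Retract
open PhaseCellIVAppA.CubeBall (center center_apply supN supN_le_norm abs_apply_le_supN norm_le_sqrt_mul_supN mem_cubeBoundary_iff)
open Literature.AlgebraicGeometry.RealAlgebraic Literature.Analysis.Calculus

variable {k t : ℕ}

/-! ## §1 Affine transport of derivative bounds; the fold conjugated to `B(x₀, ρ)` -/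

/-- **Affine transport.** If `f` is `C^∞` on an open `s ∋ cx + b` then `‖D^i(f(c· + b))(x)‖ ≤ |c|^i ‖D^if(cx + b)‖`.
[cite: Federbush1988PhaseCellIV, Theorem A.4 (A.36)–(A.38) p. 343] -/
theorem norm_iteratedFDeriv_comp_affine_le {F' : Type*} [NormedAddCommGroup F'] [NormedSpace ℝ F'] {f : Euc k → F'}
    {s : Set (Euc k)} (hs : IsOpen s) (hf : ContDiffOn ℝ ∞ f s) (c : ℝ) (b x : Euc k) (hx : c • x + b ∈ s) (i : ℕ) :
    ‖iteratedFDeriv ℝ i (fun y => f (c • y + b)) x‖ ≤ |c| ^ i * ‖iteratedFDeriv ℝ i f (c • x + b)‖ := by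
  set L : Euc k →L[ℝ] Euc k := c • ContinuousLinearMap.id ℝ (Euc k) with hL
  have hLapply : ∀ y : Euc k, L y = c • y := fun y => rfl
  set f₁ : Euc k → F' := fun w => f (w + b) with hf₁
  set s₁ : Set (Euc k) := (fun w => w + b) ⁻¹' s with hs₁
  have hs₁o : IsOpen s₁ := hs.preimage (continuous_id.add continuous_const)
  have hf₁s : ContDiffOn ℝ ∞ f₁ s₁ := hf.comp (contDiff_id.add contDiff_const).contDiffOn fun w hw => hw
  have hfun : (fun y => f (c • y + b)) = f₁ ∘ L := by funext y; simp only [comp_apply, hf₁, hLapply]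
  have hLx : L x ∈ s₁ := by show c • x + b ∈ s; exact hx
  have hpre : IsOpen (L ⁻¹' s₁) := hs₁o.preimage L.continuous
  have hxpre : x ∈ L ⁻¹' s₁ := hLx
  have key := L.iteratedFDerivWithin_comp_right (f := f₁) (n := ∞) (i := i) hf₁s hs₁o.uniqueDiffOn hpre.uniqueDiffOn hLx
    (mod_cast le_top)
  rw [iteratedFDerivWithin_of_isOpen i hpre hxpre, iteratedFDerivWithin_of_isOpen i hs₁o hLx] at key
  rw [hfun, key]
  have h1 : iteratedFDeriv ℝ i f₁ (L x) = iteratedFDeriv ℝ i f (L x + b) := iteratedFDeriv_comp_add_right i b (L x)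
  calc ‖(iteratedFDeriv ℝ i f₁ (L x)).compContinuousLinearMap fun _ => L‖ ≤ ‖iteratedFDeriv ℝ i f₁ (L x)‖ * ∏ _ : Fin i, ‖L‖ :=
        ContinuousMultilinearMap.norm_compContinuousLinearMap_le _ _
    _ ≤ ‖iteratedFDeriv ℝ i f (c • x + b)‖ * |c| ^ i := by
        rw [Finset.prod_const, Finset.card_univ, Fintype.card_fin, h1, hLapply]
        refine mul_le_mul_of_nonneg_left (pow_le_pow_left₀ (norm_nonneg _) ?_ i) (norm_nonneg _)
        rw [hL, norm_smul, Real.norm_eq_abs]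
        exact mul_le_of_le_one_right (abs_nonneg c) ContinuousLinearMap.norm_id_le
    _ = |c| ^ i * ‖iteratedFDeriv ℝ i f (c • x + b)‖ := mul_comm _ _

/-- **The fold conjugated to the ball `B(x₀, ρ)`**: `Fold(x) = x₀ + ρ·fold((x − x₀)/ρ)` — the identity for `|x − x₀| ≥ ¾ρ`,
`x₀ + (ρ/2)(x − x₀)/|x − x₀|` for `|x − x₀| ≤ ρ/2` (print's scale `d′ ≍ min(d(x, ∂D), |x − x₀|)` of (A.37) realised through the
`0`-homogeneity of the datum). [cite: Federbush1988PhaseCellIV, (A.37)–(A.38) p. 343] -/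
def Fold (x₀ : Euc k) (ρ : ℝ) (x : Euc k) : Euc k := x₀ + ρ • fold (ρ⁻¹ • (x - x₀))

/-- `|ρ^{−1}(x − x₀)| = ρ^{−1}|x − x₀|`. [cite: Federbush1988PhaseCellIV, (A.37) p. 343] -/
theorem norm_inv_smul_sub {ρ : ℝ} (hρ : 0 < ρ) (x₀ x : Euc k) : ‖ρ⁻¹ • (x - x₀)‖ = ρ⁻¹ * ‖x - x₀‖ := by
  rw [norm_smul, norm_inv, Real.norm_eq_abs, abs_of_pos hρ]

/-- `ρ^{−1}(x − x₀) ≠ 0` for `x ≠ x₀`. [cite: Federbush1988PhaseCellIV, (A.37) p. 343] -/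
theorem inv_smul_sub_ne_zero {ρ : ℝ} (hρ : 0 < ρ) {x₀ x : Euc k} (hx : x ≠ x₀) : ρ⁻¹ • (x - x₀) ≠ 0 :=
  smul_ne_zero (inv_ne_zero hρ.ne') (sub_ne_zero.2 hx)

/-- `|Fold(x) − x₀| = ρ|fold((x − x₀)/ρ)|`. [cite: Federbush1988PhaseCellIV, (A.37) p. 343] -/
theorem norm_Fold_sub {ρ : ℝ} (hρ : 0 < ρ) (x₀ x : Euc k) : ‖Fold x₀ ρ x - x₀‖ = ρ * ‖fold (ρ⁻¹ • (x - x₀))‖ := by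
  rw [Fold, add_sub_cancel_left, norm_smul, Real.norm_eq_abs, abs_of_pos hρ]

/-- `|Fold(x) − x₀| ≥ ρ/2` for `x ≠ x₀`. [cite: Federbush1988PhaseCellIV, (A.37) p. 343] -/
theorem half_le_norm_Fold_sub {ρ : ℝ} (hρ : 0 < ρ) {x₀ x : Euc k} (hx : x ≠ x₀) : ρ / 2 ≤ ‖Fold x₀ ρ x - x₀‖ := by
  rw [norm_Fold_sub hρ]
  have := half_le_norm_fold (inv_smul_sub_ne_zero hρ hx)
  nlinarith

/-- `|Fold(x) − x₀| ≤ max(ρ/2, |x − x₀|)` for `x ≠ x₀`. [cite: Federbush1988PhaseCellIV, (A.37) p. 343] -/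
theorem norm_Fold_sub_le {ρ : ℝ} (hρ : 0 < ρ) {x₀ x : Euc k} (hx : x ≠ x₀) : ‖Fold x₀ ρ x - x₀‖ ≤ max (ρ / 2) ‖x - x₀‖ := by
  rw [norm_Fold_sub hρ]
  have h := norm_fold_le (inv_smul_sub_ne_zero hρ hx)
  rw [norm_inv_smul_sub hρ] at h
  calc ρ * ‖fold (ρ⁻¹ • (x - x₀))‖ ≤ ρ * max (1 / 2) (ρ⁻¹ * ‖x - x₀‖) := mul_le_mul_of_nonneg_left h hρ.le
    _ = max (ρ / 2) ‖x - x₀‖ := by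
        rw [mul_max_of_nonneg _ _ hρ.le, ← mul_assoc, mul_inv_cancel₀ hρ.ne', one_mul]
        ring_nf

/-- `Fold(x) = x` for `|x − x₀| ≥ ¾ρ`. [cite: Federbush1988PhaseCellIV, (A.37) p. 343] -/
theorem Fold_eq_self {ρ : ℝ} (hρ : 0 < ρ) {x₀ x : Euc k} (hx : 3 * ρ / 4 ≤ ‖x - x₀‖) : Fold x₀ ρ x = x := by
  have h34 : 3 / 4 ≤ ‖ρ⁻¹ • (x - x₀)‖ := by
    rw [norm_inv_smul_sub hρ, le_inv_mul_iff₀ hρ]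
    linarith
  rw [Fold, fold_eq_self h34, smul_smul, mul_inv_cancel₀ hρ.ne', one_smul, add_sub_cancel]

/-- `Fold` is `C^∞` off `x₀`. [cite: Federbush1988PhaseCellIV, (A.37) p. 343] -/
theorem contDiffOn_Fold {ρ : ℝ} (hρ : 0 < ρ) (x₀ : Euc k) : ContDiffOn ℝ ∞ (Fold x₀ ρ) {x | x ≠ x₀} := by
  have h1 : ContDiff ℝ ∞ fun x : Euc k => ρ⁻¹ • (x - x₀) := (contDiff_id.sub contDiff_const).const_smul _
  have h2 : ContDiffOn ℝ ∞ (fun z : Euc k => x₀ + ρ • fold z) {z | z ≠ 0} :=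
    contDiffOn_const.add (contDiffOn_fold.const_smul ρ)
  change ContDiffOn ℝ ∞ ((fun z : Euc k => x₀ + ρ • fold z) ∘ fun x => ρ⁻¹ • (x - x₀)) _
  exact h2.comp h1.contDiffOn fun x hx => inv_smul_sub_ne_zero hρ hx

/-! ## §2 Elementary cube geometry about the singular point -/

/-- A point within `δ` of the centre has all face distances `≥ ½ − δ`. [cite: Federbush1988PhaseCellIV, Centering Property
p. 338] -/
theorem face_dist_of_dist_center_le {x₀ : Euc k} {δ : ℝ} (h : dist x₀ (center k) ≤ δ) (i : Fin k) :
    1 / 2 - δ ≤ x₀ i ∧ 1 / 2 - δ ≤ 1 - x₀ i := by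
  have h1 : |(x₀ - center k) i| ≤ supN (x₀ - center k) := abs_apply_le_supN _ i
  have h2 : supN (x₀ - center k) ≤ ‖x₀ - center k‖ := supN_le_norm _
  have h3 : ‖x₀ - center k‖ ≤ δ := by rwa [← dist_eq_norm]
  have h4 : (x₀ - center k) i = x₀ i - 1 / 2 := by simp
  rw [h4, abs_le] at h1
  constructor <;> linarith

/-- Two points of the unit cube are at distance `≤ √k`. [cite: Federbush1988PhaseCellIV, Appendix A p. 339] -/
theorem norm_sub_le_sqrt_of_mem_unitCube {x x₀ : Euc k} (hx : x ∈ unitCube k) (hx₀ : x₀ ∈ unitCube k) :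
    ‖x - x₀‖ ≤ Real.sqrt k := by
  refine (norm_le_sqrt_mul_supN (x - x₀)).trans ?_
  have hsup : supN (x - x₀) ≤ 1 := by
    refine (pi_norm_le_iff_of_nonneg zero_le_one).mpr fun i => ?_
    have h1 := hx i
    have h2 := hx₀ i
    rw [Real.norm_eq_abs, abs_le]
    change -1 ≤ x i - x₀ i ∧ x i - x₀ i ≤ 1
    constructor <;> linarith [h1.1, h1.2, h2.1, h2.2]
  calc Real.sqrt k * supN (x - x₀) ≤ Real.sqrt k * 1 := mul_le_mul_of_nonneg_left hsup (Real.sqrt_nonneg _)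
    _ = Real.sqrt k := mul_one _

/-- A boundary point is at distance `≥ μ` from a point with all face distances `≥ μ`. [cite: Federbush1988PhaseCellIV, (A.37)
p. 343; Centering Property p. 338] -/
theorem le_norm_sub_of_mem_cubeBoundary {x₀ y : Euc k} {μ : ℝ} (hμ₀ : ∀ i, μ ≤ x₀ i) (hμ₁ : ∀ i, μ ≤ 1 - x₀ i)
    (hy : y ∈ cubeBoundary k) : μ ≤ ‖y - x₀‖ := by
  obtain ⟨-, i, hi⟩ := mem_cubeBoundary_iff.mp hy
  have hc : |y i - x₀ i| ≤ ‖y - x₀‖ := by rw [← dist_eq_norm]; exact abs_apply_sub_le_dist y x₀ i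
  refine le_trans ?_ hc
  rcases hi with hi | hi <;> rw [hi]
  · rw [zero_sub, abs_neg]; exact (hμ₀ i).trans (le_abs_self _)
  · exact (hμ₁ i).trans (le_abs_self _)

/-! ## §3 Geometric Construction 6 for uniformly smoothly retractable targets -/

set_option maxHeartbeats 800000 in
/-- **Geometric Construction 6 of [Federbush1988PhaseCellIV] §11 (= Theorem A.4 on the unit `k`-cube, decl `GeomConstruction6`,
with the p. 339 «Caution» cap), for every centering radius `δ < ½` and every target `M ⊆ R^t` that is a uniform smooth
neighbourhood retract** (`r > 0`, `C^∞` `P` with `P(y) ∈ M` for `d(y, M) < r`, `P = id` on `M`, `‖D^iP‖ ≤ C_i` on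
`{d(·, M) < r}`): for every cap `c₁` there are constants `c_m` such that for every `x₀` with `d(x₀, c(H)) ≤ δ` and every
Lipschitz `φ′ : ∂H → M` with `Λ₁(φ′) ≤ c₁` there is `ᵉφ′ : H − x₀ → M`, `= φ′` on `∂H` (11.12), continuous, `C^∞` on the open
cube minus `x₀`, with (11.13) `‖D^m ᵉφ′(x)‖ ≤ c_m max(d(x, ∂D)^{−(m−1)}, d(x, x₀)^{−(m−1)}) d(x, x₀)^{−1} Λ₁(φ′)`.
[cite: Federbush1988PhaseCellIV, Geometric Construction 6 (11.12)–(11.13) p. 338–339; Theorem A.4 (A.34)–(A.38) p. 343;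
«Caution» p. 339] -/
theorem geomConstruction6_of_retract {M : Set (EuclideanSpace ℝ (Fin t))}
    {P : EuclideanSpace ℝ (Fin t) → EuclideanSpace ℝ (Fin t)} {r : ℝ} (hr : 0 < r) (hP : ContDiff ℝ ∞ P)
    (hPM : ∀ y, infDist y M < r → P y ∈ M) (hPid : ∀ y ∈ M, P y = y)
    (hPb : ∀ i : ℕ, ∃ C : ℝ, ∀ y, infDist y M < r → ‖iteratedFDeriv ℝ i P y‖ ≤ C) (k : ℕ) {δ : ℝ} (hδ : δ < 1 / 2) :
    GeomConstruction6 k t M δ := by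
  rcases Nat.eq_zero_or_pos k with rfl | hk
  · -- dimension `0`: `H` is the point `x₀`, `H − x₀ = ∅`, every clause is vacuous
    intro c₁
    refine ⟨fun _ => 0, fun x₀ _ fφ _ => ?_⟩
    have hzero : ∀ y : Euc 0, y = x₀ := fun y => by
      rw [norm_eq_zero.mp (norm_eq_zero_of_dim_zero y), norm_eq_zero.mp (norm_eq_zero_of_dim_zero x₀)]
    have hempty : ∀ S : Set (Euc 0), S \ {x₀} = ∅ := fun S =>
      eq_empty_of_forall_notMem fun y hy => hy.2 (mem_singleton_iff.2 (hzero y))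
    refine ⟨fun _ => 0, ?_, fun x => ?_, ?_, ?_, fun m _ K _ _ x hx => ?_⟩
    · rw [hempty]; exact mapsTo_empty _ _
    · exfalso
      have : (x : Euc 0) ∈ interior (unitCube 0) := by
        rw [mem_interior_unitCube_iff]; exact fun i => Fin.elim0 i
      exact x.2.2 this
    · rw [hempty]; exact continuousOn_empty _
    · rw [hempty]; exact contDiffOn_empty
    · rw [hempty] at hx; exact absurd hx (notMem_empty _)
  · haveI : NeZero k := ⟨hk.ne'⟩
    intro c₁
    -- the geometry constants
    set μ : ℝ := 1 / 2 - δ with hμ_def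
    have hμ : 0 < μ := by rw [hμ_def]; linarith
    set ρ : ℝ := μ / 2 with hρ_def
    have hρ : 0 < ρ := by positivity
    have hk1 : 0 < Real.sqrt k := Real.sqrt_pos.2 (by exact_mod_cast hk)
    -- Lipschitz constants
    set L : ℝ≥0 := lipschitzExtensionConstant (Euc t) with hL
    set Cπ : ℝ≥0 := Real.toNNReal (Real.sqrt k / (ρ / 2) * (1 + Real.sqrt k / μ)) with hCπ
    set CK : ℝ≥0 := L * (L * Cπ) with hCK
    set ε : ℝ := min (1 / 4) (r / (8 * (CK * c₁ + 1))) with hε_def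
    have hε : 0 < ε := lt_min (by norm_num) (by positivity)
    have hε4 : ε ≤ 1 / 4 := min_le_left _ _
    have hεr : 4 * ε * (CK * c₁) < r := by
      have h1 : 4 * ε * (CK * c₁) ≤ 4 * (r / (8 * (CK * c₁ + 1))) * (CK * c₁) := by gcongr; exact min_le_right _ _
      have h2 : 4 * (r / (8 * (CK * c₁ + 1))) * (CK * c₁) = r / 2 * (CK * c₁ / (CK * c₁ + 1)) := by field_simp; ring
      have h3 : (CK * c₁ : ℝ) / (CK * c₁ + 1) < 1 := (div_lt_one (by positivity)).2 (lt_add_one _)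
      nlinarith [mul_nonneg CK.coe_nonneg c₁.coe_nonneg]
    -- the cube engine of Construction 5
    have hσ_def : ∀ x, (cubeSystem k).σ x = msize x := fun _ => rfl
    have hσ_le_one : ∀ x, (cubeSystem k).σ x ≤ 1 := (cubeSystem k).σ_le_one
    have hopen : IsOpen {y : Euc k | 0 < (cubeSystem k).σ y} := isOpen_lt continuous_const (cubeSystem k).continuous_σ
    have hA : ∀ m : ℕ, ∃ A : ℝ, 0 ≤ A ∧ ∀ (g : Euc k → Euc t) (K : ℝ≥0), LipschitzWith K g → ∀ i, 1 ≤ i → i ≤ m →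
        ∀ x, 0 < (cubeSystem k).σ x →
          ‖iteratedFDeriv ℝ i ((cubeSystem k).smooth ε g) x‖ ≤ A * K * (((cubeSystem k).σ x)⁻¹) ^ (i - 1) :=
      fun m => (cubeSystem k).exists_deriv_bound m hε
    choose A hA0 hA using hA
    choose Cf hCf using hPb
    set Cmax : ℕ → ℝ := fun m => ∑ i ∈ Finset.range (m + 1), max (Cf i) 0 with hCmax
    have hCmax_ge : ∀ m i, i ≤ m → Cf i ≤ Cmax m := fun m i hi =>
      (le_max_left _ _).trans (Finset.single_le_sum (f := fun i => max (Cf i) 0) (fun i _ => le_max_right _ _)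
        (by rw [Finset.mem_range]; omega))
    have hCmax0 : ∀ m, 0 ≤ Cmax m := fun m => Finset.sum_nonneg fun i _ => le_max_right _ _
    -- the fold constants
    have hTf : ∀ i : ℕ, ∃ T : ℝ, 0 ≤ T ∧ ∀ x : Euc k, x ≠ 0 → ‖x‖ ≤ 1 →
        ‖iteratedFDeriv ℝ i (fold : Euc k → Euc k) x‖ ≤ T * (‖x‖⁻¹) ^ i := fun i => exists_fold_bound i
    choose Tf hTf0 hTf using hTf
    set Tm : ℕ → ℝ := fun m => max 1 (∑ i ∈ Finset.range (m + 1), Tf i) with hTm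
    have hTm1 : ∀ m, 1 ≤ Tm m := fun m => le_max_left _ _
    have hTm_ge : ∀ m i, i ≤ m → Tf i ≤ Tm m := fun m i hi =>
      (Finset.single_le_sum (f := Tf) (fun i _ => hTf0 i) (by rw [Finset.mem_range]; omega)).trans (le_max_right _ _)
    -- the constants of the two regimes
    set U₁ : ℕ → ℝ := fun m => max 1 (A m * (CK * c₁)) with hU₁
    set U₂ : ℕ → ℝ := fun m => max 1 (m ! * A m * (CK * c₁) * ρ) with hU₂
    have hU₁1 : ∀ m, 1 ≤ U₁ m := fun m => le_max_left _ _
    have hU₂1 : ∀ m, 1 ≤ U₂ m := fun m => le_max_left _ _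
    set c1 : ℕ → ℝ := fun m => m ! * Cmax m * U₁ m ^ (m - 1) * (A m * CK) * Real.sqrt k with hc1
    set c2 : ℕ → ℝ := fun m => m ! * Cmax m * U₂ m ^ (m - 1) * (m ! * A m * Tm m ^ m) * CK * ρ with hc2
    have hc1_0 : ∀ m, 0 ≤ c1 m := fun m => by
      have := hA0 m; have := hCmax0 m; have := hU₁1 m; positivity
    have hc2_0 : ∀ m, 0 ≤ c2 m := fun m => by
      have := hA0 m; have := hCmax0 m; have := hU₂1 m; have := hTm1 m; positivity
    refine ⟨fun m => c1 m + c2 m, fun x₀ hx₀ fφ hf => ?_⟩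
    obtain ⟨K₀, hK₀c, hK₀⟩ := hf
    -- face distances of `x₀`
    have hμ₀ : ∀ i, μ ≤ x₀ i := fun i => (face_dist_of_dist_center_le hx₀ i).1
    have hμ₁ : ∀ i, μ ≤ 1 - x₀ i := fun i => (face_dist_of_dist_center_le hx₀ i).2
    have hmx₀ : μ ≤ msize x₀ := le_msize_iff.2 fun i => le_min (hμ₀ i) (hμ₁ i)
    have hx₀D : x₀ ∈ unitCube k := fun i => ⟨by linarith [hμ₀ i], by linarith [hμ₁ i]⟩
    -- the least Lipschitz constant of the datum
    set Ks : ℝ≥0 := sInf {K : ℝ≥0 | LipschitzWith K fφ} with hKs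
    have hKs_lip : LipschitzWith Ks fφ := lipschitzWith_sInf hK₀
    have hKs_le : ∀ K : ℝ≥0, LipschitzWith K fφ → Ks ≤ K := fun K hK => sInf_lipschitz_le hK
    have hKsc : Ks ≤ c₁ := (hKs_le K₀ hK₀).trans hK₀c
    -- the `0`-homogeneous extension `g = φ′ ∘ π_{x₀}` and its Lipschitz extension
    obtain ⟨Φb, hΦbL, hΦbeq⟩ := exists_lipschitz_extension_of_set fφ hKs_lip
    set Aset : Set (Euc k) := {y | ρ / 2 ≤ ‖y - x₀‖} with hAset
    have hπL : LipschitzOnWith Cπ (proj x₀) Aset := lipschitzOnWith_proj hμ hμ₀ hμ₁ (half_pos hρ)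
    have hg₀L : LipschitzOnWith (L * Ks * Cπ) (Φb ∘ proj x₀) Aset := hΦbL.comp_lipschitzOnWith hπL
    obtain ⟨g, hgL', hgeq⟩ := hg₀L.extend_finite_dimension
    have hgL : LipschitzWith (CK * Ks) g := hgL'.weaken (le_of_eq (by rw [hCK]; ring))
    have hbdA : ∀ y ∈ cubeBoundary k, y ∈ Aset := fun y hy =>
      le_trans (by rw [hρ_def]; linarith) (le_norm_sub_of_mem_cubeBoundary hμ₀ hμ₁ hy)
    have hgφ : ∀ y : ↥(cubeBoundary k), g y = (fφ y : Euc t) := fun y => by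
      rw [← hgeq (hbdA y y.2), comp_apply, proj_eq_self hμ hμ₀ hμ₁ y.2, hΦbeq y]
    have hgM : ∀ y ∈ Aset, g y ∈ M := fun y hy => by
      have hy0 : y ≠ x₀ := by
        intro h; rw [h, hAset, mem_setOf_eq, sub_self, norm_zero] at hy; linarith
      have hmem : proj x₀ y ∈ cubeBoundary k := proj_mem_cubeBoundary hμ hμ₀ hμ₁ hy0
      rw [← hgeq hy, comp_apply, hΦbeq ⟨proj x₀ y, hmem⟩]
      exact (fφ ⟨proj x₀ y, hmem⟩).2
    -- the smoothed map `u = f_ε(ḡ)` and the extension `ᵉφ′ = Pr_M ∘ u ∘ Fold`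
    obtain ⟨u, hu⟩ : ∃ u : Euc k → Euc t, u = (cubeSystem k).smooth ε g := ⟨_, rfl⟩
    have hu_cont : Continuous u := by rw [hu]; exact (cubeSystem k).continuous_smooth hε hgL
    have hu_smooth : ContDiffOn ℝ ∞ u {y | 0 < (cubeSystem k).σ y} := by
      rw [hu]; exact (cubeSystem k).contDiffOn_smooth hgL.continuous
    have hclose : ∀ y ∈ unitCube k, y ∈ Aset → infDist (u y) M < r := by
      intro y hy hyA
      have h1 : infDist (u y) M ≤ dist (u y) (g y) := infDist_le_dist_of_mem (hgM y hyA)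
      have h2 : dist (u y) (g y) ≤ 4 * ε * (CK * Ks) * max ((cubeSystem k).σ y) 0 := by
        rw [dist_eq_norm, hu]; exact (cubeSystem k).norm_smooth_sub_le' hε hgL y
      have h3 : max ((cubeSystem k).σ y) 0 ≤ 1 := max_le (hσ_le_one y) zero_le_one
      have h4 : 4 * ε * ((CK : ℝ) * Ks) * max ((cubeSystem k).σ y) 0 ≤ 4 * ε * (CK * c₁) * 1 := by gcongr
      linarith
    -- where the fold lands
    have hFoldA : ∀ x, x ≠ x₀ → Fold x₀ ρ x ∈ Aset := fun x hx => half_le_norm_Fold_sub hρ hx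
    have hFold_cases : ∀ x, x ≠ x₀ → Fold x₀ ρ x = x ∨ 0 < msize (Fold x₀ ρ x) := by
      intro x hx
      by_cases h34 : 3 * ρ / 4 ≤ ‖x - x₀‖
      · exact Or.inl (Fold_eq_self hρ h34)
      · right
        rw [not_le] at h34
        have h1 : ‖Fold x₀ ρ x - x₀‖ ≤ 3 * ρ / 4 :=
          (norm_Fold_sub_le hρ hx).trans (max_le (by linarith) h34.le)
        have h2 := msize_le_msize_add_dist x₀ (Fold x₀ ρ x)
        rw [dist_eq_norm, ← norm_sub_rev] at h2
        rw [hρ_def] at h1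
        linarith
    have hFoldD : ∀ x ∈ unitCube k \ {x₀}, Fold x₀ ρ x ∈ unitCube k := by
      intro x hx
      have hx0 : x ≠ x₀ := fun h => hx.2 (mem_singleton_iff.2 h)
      rcases hFold_cases x hx0 with h | h
      · rw [h]; exact hx.1
      · exact interior_subset (msize_pos_iff_mem_interior.1 h)
    have hFold_int : ∀ x ∈ interior (unitCube k) \ {x₀}, Fold x₀ ρ x ∈ {y | 0 < (cubeSystem k).σ y} := by
      intro x hx
      have hx0 : x ≠ x₀ := fun h => hx.2 (mem_singleton_iff.2 h)
      rcases hFold_cases x hx0 with h | h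
      · rw [h]; exact msize_pos_iff_mem_interior.2 hx.1
      · exact h
    refine ⟨P ∘ u ∘ Fold x₀ ρ, fun x hx => hPM _ (hclose _ (hFoldD x hx) (hFoldA x fun h => hx.2 (mem_singleton_iff.2 h))),
      fun x => ?_, ?_, ?_, fun m hm K hKc hK x hx => ?_⟩
    · -- (11.12) boundary values: `Fold = id`, `u = ḡ = φ′` on `∂H`, `P = id` on `M`
      have hxA : 3 * ρ / 4 ≤ ‖(x : Euc k) - x₀‖ :=
        le_trans (by rw [hρ_def]; linarith) (le_norm_sub_of_mem_cubeBoundary hμ₀ hμ₁ x.2)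
      show P (u (Fold x₀ ρ x)) = _
      rw [Fold_eq_self hρ hxA, hu, (cubeSystem k).smooth_eq_of_nonpos (msize_nonpos_of_mem_cubeBoundary x.2), hgφ x]
      exact hPid _ (fφ x).2
    · -- continuity on `H − x₀`
      exact (hP.continuous.comp hu_cont).comp_continuousOn
        ((contDiffOn_Fold hρ x₀).continuousOn.mono fun x hx h => hx.2 (mem_singleton_iff.2 h))
    · -- smoothness on the open cube minus `x₀`
      exact (hP.comp_contDiffOn hu_smooth).comp ((contDiffOn_Fold hρ x₀).mono fun x hx h => hx.2 (mem_singleton_iff.2 h))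
        hFold_int
    · -- (11.13)
      obtain ⟨j, rfl⟩ := Nat.exists_eq_add_of_le' hm
      simp only [Nat.add_sub_cancel]
      have hx0 : x ≠ x₀ := fun h => hx.2 (mem_singleton_iff.2 h)
      have hxint : x ∈ interior (unitCube k) := hx.1
      have hxD : x ∈ unitCube k := interior_subset hxint
      have hdx : 0 < ‖x - x₀‖ := norm_pos_iff.2 (sub_ne_zero.2 hx0)
      rw [dist_eq_norm]
      have hKsK : (Ks : ℝ) ≤ K := NNReal.coe_le_coe.2 (hKs_le K hK)
      have hMAX0 : 0 ≤ max ((infDist x (cubeBoundary k))⁻¹ ^ j) (‖x - x₀‖⁻¹ ^ j) :=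
        le_max_of_le_right (pow_nonneg (inv_nonneg.2 (norm_nonneg _)) _)
      have hfinal : ∀ B : ℝ, B ≤ c1 (j + 1) + c2 (j + 1) →
          ‖iteratedFDeriv ℝ (j + 1) (P ∘ u ∘ Fold x₀ ρ) x‖ ≤
            B * max ((infDist x (cubeBoundary k))⁻¹ ^ j) (‖x - x₀‖⁻¹ ^ j) * ‖x - x₀‖⁻¹ * K →
          ‖iteratedFDeriv ℝ (j + 1) (P ∘ u ∘ Fold x₀ ρ) x‖ ≤
            (c1 (j + 1) + c2 (j + 1)) * max ((infDist x (cubeBoundary k))⁻¹ ^ j) (‖x - x₀‖⁻¹ ^ j) * ‖x - x₀‖⁻¹ * K :=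
        fun B hB h => h.trans (mul_le_mul_of_nonneg_right (mul_le_mul_of_nonneg_right
          (mul_le_mul_of_nonneg_right hB hMAX0) (inv_nonneg.2 (norm_nonneg _))) K.coe_nonneg)
      by_cases h34 : 3 * ρ / 4 < ‖x - x₀‖
      · -- REGIME 1: away from `x₀` the fold is the identity near `x`: Construction 5 verbatim
        have hev : (P ∘ u ∘ Fold x₀ ρ) =ᶠ[𝓝 x] (P ∘ u) := by
          have hop : IsOpen {y : Euc k | 3 * ρ / 4 < ‖y - x₀‖} :=
            isOpen_lt continuous_const ((continuous_id.sub continuous_const).norm)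
          filter_upwards [hop.mem_nhds h34] with y hy
          simp only [comp_apply, Fold_eq_self hρ (le_of_lt hy)]
        have hσ : 0 < (cubeSystem k).σ x := by rw [hσ_def, msize_pos_iff_mem_interior]; exact hxint
        have hxA : x ∈ Aset := by show ρ / 2 ≤ ‖x - x₀‖; linarith
        have hPt : ∀ i ≤ j + 1, ‖iteratedFDeriv ℝ i P (u x)‖ ≤ Cmax (j + 1) := fun i hi =>
          (hCf i _ (hclose x hxD hxA)).trans (hCmax_ge (j + 1) i hi)
        have hΦb : ∀ i, 1 ≤ i → i ≤ j + 1 →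
            ‖iteratedFDeriv ℝ i u x‖ ≤ (A (j + 1) * (CK * Ks) * (cubeSystem k).σ x) * (((cubeSystem k).σ x)⁻¹) ^ i := by
          intro i hi1 hi
          rw [hu]
          refine (hA (j + 1) g (CK * Ks) hgL i hi1 hi x hσ).trans (le_of_eq ?_)
          obtain ⟨i', rfl⟩ := Nat.exists_eq_add_of_le' hi1
          rw [Nat.add_sub_cancel, pow_succ, NNReal.coe_mul]
          field_simp
        have hu0 : 0 ≤ A (j + 1) * (CK * Ks) * (cubeSystem k).σ x := by have := hA0 (j + 1); positivity
        have huU : A (j + 1) * (CK * Ks) * (cubeSystem k).σ x ≤ U₁ (j + 1) := by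
          refine le_trans ?_ (le_max_right _ _)
          calc A (j + 1) * (CK * Ks) * (cubeSystem k).σ x ≤ A (j + 1) * (CK * c₁) * 1 := by
                have := hA0 (j + 1); have := hσ_le_one x; gcongr
            _ = A (j + 1) * (CK * c₁) := mul_one _
        have key := norm_iteratedFDeriv_comp_le_of_scale hopen hσ hu_smooth hP hm hσ hu0 huU (hU₁1 (j + 1)) hPt hΦb
        rw [Nat.add_sub_cancel] at key
        -- geometry: `m(x)^{-1} ≤ d(x, ∂D)^{-1}`, `1 ≤ √k/|x − x₀|`
        have hd0 : 0 < infDist x (cubeBoundary k) :=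
          (isClosed_frontier.notMem_iff_infDist_pos ⟨0, zero_mem_cubeBoundary⟩).1 fun h => h.2 hxint
        have hdσ : ((cubeSystem k).σ x)⁻¹ ≤ (infDist x (cubeBoundary k))⁻¹ :=
          (inv_le_inv₀ hσ hd0).2 (infDist_cubeBoundary_le_msize hxD)
        have hone : 1 ≤ Real.sqrt k * ‖x - x₀‖⁻¹ := by
          rw [← div_eq_mul_inv, le_div_iff₀ hdx, one_mul]
          exact norm_sub_le_sqrt_of_mem_unitCube hxD hx₀D
        have hσ0 : (cubeSystem k).σ x ≠ 0 := hσ.ne'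
        set B₁ : ℝ := (j + 1)! * Cmax (j + 1) * U₁ (j + 1) ^ j * (A (j + 1) * CK) with hB₁
        have hB₁0 : 0 ≤ B₁ := by have := hA0 (j + 1); have := hCmax0 (j + 1); have := hU₁1 (j + 1); positivity
        have hB₁c : B₁ * Real.sqrt k = c1 (j + 1) := by simp only [hB₁, hc1, Nat.add_sub_cancel]
        have hle : (infDist x (cubeBoundary k))⁻¹ ^ j ≤ max ((infDist x (cubeBoundary k))⁻¹ ^ j) (‖x - x₀‖⁻¹ ^ j) :=
          le_max_left _ _
        refine hfinal (B₁ * Real.sqrt k) (le_add_of_le_of_nonneg (le_of_eq hB₁c) (hc2_0 _)) ?_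
        calc ‖iteratedFDeriv ℝ (j + 1) (P ∘ u ∘ Fold x₀ ρ) x‖ = ‖iteratedFDeriv ℝ (j + 1) (P ∘ u) x‖ := by
              rw [(hev.iteratedFDeriv ℝ (j + 1)).eq_of_nhds]
          _ ≤ (j + 1)! * Cmax (j + 1) * U₁ (j + 1) ^ j * (A (j + 1) * (CK * Ks) * (cubeSystem k).σ x) *
                (((cubeSystem k).σ x)⁻¹) ^ (j + 1) := key
          _ = B₁ * (((cubeSystem k).σ x)⁻¹) ^ j * Ks := by rw [pow_succ, hB₁]; field_simp
          _ ≤ B₁ * ((infDist x (cubeBoundary k))⁻¹ ^ j) * K :=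
              mul_le_mul (mul_le_mul_of_nonneg_left (pow_le_pow_left₀ (inv_nonneg.2 hσ.le) hdσ j) hB₁0) hKsK
                Ks.coe_nonneg (by positivity)
          _ ≤ B₁ * max ((infDist x (cubeBoundary k))⁻¹ ^ j) (‖x - x₀‖⁻¹ ^ j) * K := by gcongr
          _ = B₁ * max ((infDist x (cubeBoundary k))⁻¹ ^ j) (‖x - x₀‖⁻¹ ^ j) * 1 * K := by rw [mul_one]
          _ ≤ B₁ * max ((infDist x (cubeBoundary k))⁻¹ ^ j) (‖x - x₀‖⁻¹ ^ j) * (Real.sqrt k * ‖x - x₀‖⁻¹) * K := by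
              gcongr
          _ = B₁ * Real.sqrt k * max ((infDist x (cubeBoundary k))⁻¹ ^ j) (‖x - x₀‖⁻¹ ^ j) * ‖x - x₀‖⁻¹ * K := by
              ring
      · -- REGIME 2: near `x₀`, rescale to the unit ball `z = (x − x₀)/ρ` and go through the fold
        rw [not_lt] at h34
        set z : Euc k := ρ⁻¹ • (x - x₀) with hz
        have hz0 : z ≠ 0 := inv_smul_sub_ne_zero hρ hx0
        have hnz : ‖z‖ = ρ⁻¹ * ‖x - x₀‖ := norm_inv_smul_sub hρ x₀ x
        have hz1 : ‖z‖ < 1 := by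
          rw [hnz, inv_mul_lt_iff₀ hρ]; linarith
        have hzb : z ∈ ball (0 : Euc k) 1 := by rwa [mem_ball, dist_zero_right]
        have hnz0 : 0 < ‖z‖ := norm_pos_iff.2 hz0
        -- the outer map in the rescaled variable
        obtain ⟨v, hv⟩ : ∃ v : Euc k → Euc t, v = fun w => u (ρ • w + x₀) := ⟨_, rfl⟩
        have hσw : ∀ w : Euc k, ‖w‖ < 1 → ρ ≤ (cubeSystem k).σ (ρ • w + x₀) := by
          intro w hw
          have h1 := msize_le_msize_add_dist x₀ (ρ • w + x₀)
          have h2 : dist x₀ (ρ • w + x₀) = ρ * ‖w‖ := by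
            rw [dist_eq_norm, show x₀ - (ρ • w + x₀) = -(ρ • w) by abel, norm_neg, norm_smul, Real.norm_eq_abs,
              abs_of_pos hρ]
          rw [h2] at h1
          rw [hσ_def]
          have h3 : ρ * ‖w‖ ≤ ρ * 1 := mul_le_mul_of_nonneg_left hw.le hρ.le
          linarith
        have hv_smooth : ContDiffOn ℝ ∞ v (ball (0 : Euc k) 1) := by
          rw [hv]
          refine hu_smooth.comp ((contDiff_id.const_smul ρ).add contDiff_const).contDiffOn fun w hw => ?_
          have hw' : ‖w‖ < 1 := by rwa [mem_ball, dist_zero_right] at hw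
          exact hρ.trans_le (hσw w hw')
        set y : Euc k := fold z with hy
        have hyb : y ∈ ball (0 : Euc k) 1 := fold_mem_ball hz0 hzb
        have hy1 : ‖y‖ < 1 := by rwa [mem_ball, dist_zero_right] at hyb
        have hFx : Fold x₀ ρ x = ρ • y + x₀ := by rw [Fold, hy, hz, add_comm]
        have hypos : ρ • y + x₀ ∈ {w : Euc k | 0 < (cubeSystem k).σ w} := hρ.trans_le (hσw y hy1)
        -- flat bounds on the outer map at `fold z`
        have hub : ∀ i, 1 ≤ i → i ≤ j + 1 →
            ‖iteratedFDeriv ℝ i v y‖ ≤ (A (j + 1) * (CK * Ks) * ρ) * ((1 : ℝ)⁻¹) ^ (i - 1) := by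
          intro i hi1 him
          rw [inv_one, one_pow, mul_one, hv]
          have h1 := norm_iteratedFDeriv_comp_affine_le hopen hu_smooth ρ x₀ y hypos i
          have h2 : ‖iteratedFDeriv ℝ i u (ρ • y + x₀)‖ ≤
              A (j + 1) * (CK * Ks) * (((cubeSystem k).σ (ρ • y + x₀))⁻¹) ^ (i - 1) := by
            rw [hu]; exact hA (j + 1) g (CK * Ks) hgL i hi1 him (ρ • y + x₀) (hρ.trans_le (hσw y hy1))
          have h3 : (((cubeSystem k).σ (ρ • y + x₀))⁻¹) ^ (i - 1) ≤ (ρ⁻¹) ^ (i - 1) :=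
            pow_le_pow_left₀ (inv_nonneg.2 (hρ.le.trans (hσw y hy1))) ((inv_le_inv₀ (hρ.trans_le (hσw y hy1)) hρ).2
              (hσw y hy1)) _
          have hAK : 0 ≤ A (j + 1) * (CK * Ks) := by have := hA0 (j + 1); positivity
          calc ‖iteratedFDeriv ℝ i (fun w => u (ρ • w + x₀)) y‖ ≤ |ρ| ^ i * ‖iteratedFDeriv ℝ i u (ρ • y + x₀)‖ := h1
            _ ≤ ρ ^ i * (A (j + 1) * (CK * Ks) * (ρ⁻¹) ^ (i - 1)) := by
                rw [abs_of_pos hρ]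
                exact mul_le_mul_of_nonneg_left (h2.trans (mul_le_mul_of_nonneg_left h3 hAK)) (by positivity)
            _ = A (j + 1) * (CK * Ks) * ρ := by
                obtain ⟨i', rfl⟩ := Nat.exists_eq_add_of_le' hi1
                rw [Nat.add_sub_cancel, pow_succ, inv_pow]
                field_simp
        have hTb : ∀ i ≤ j + 1, ‖iteratedFDeriv ℝ i (fold : Euc k → Euc k) z‖ ≤ Tm (j + 1) * (‖z‖⁻¹) ^ i := fun i hi =>
          (hTf i z hz0 hz1.le).trans (mul_le_mul_of_nonneg_right (hTm_ge (j + 1) i hi) (by positivity))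
        have ha0 : 0 ≤ A (j + 1) * (CK * Ks) * ρ := by have := hA0 (j + 1); positivity
        -- the open punctured ball and `Φ = v ∘ fold`
        set s : Set (Euc k) := ball (0 : Euc k) 1 ∩ {w | w ≠ 0} with hs_def
        have hs : IsOpen s := isOpen_ball.inter isOpen_ne
        have hzs : z ∈ s := ⟨hzb, hz0⟩
        have hΦ : ContDiffOn ℝ ∞ (v ∘ fold) s :=
          hv_smooth.comp (contDiffOn_fold.mono fun w hw => hw.2) fun w hw => fold_mem_ball hw.2 hw.1
        have hW0 : 0 < ‖z‖⁻¹ := by positivity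
        have hΦb : ∀ i, 1 ≤ i → i ≤ j + 1 →
            ‖iteratedFDeriv ℝ i (v ∘ fold) z‖ ≤ ((j + 1)! * (A (j + 1) * (CK * Ks) * ρ)) * ((Tm (j + 1) * ‖z‖⁻¹)⁻¹)⁻¹ ^ i := by
          intro i hi1 him
          rw [inv_inv]
          have h1 : ‖iteratedFDeriv ℝ i (v ∘ fold) z‖ ≤
              i ! * (A (j + 1) * (CK * Ks) * ρ * 1) * (Tm (j + 1) * (1 * ‖z‖)⁻¹) ^ i :=
            norm_iteratedFDeriv_comp_fold_le hv_smooth one_pos le_rfl ha0 (hTm1 (j + 1)) hz0 hzb hub hTb hi1 him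
          have h2 : (i ! : ℝ) ≤ (j + 1)! := by exact_mod_cast Nat.factorial_le him
          calc ‖iteratedFDeriv ℝ i (v ∘ fold) z‖ ≤ i ! * (A (j + 1) * (CK * Ks) * ρ * 1) * (Tm (j + 1) * (1 * ‖z‖)⁻¹) ^ i := h1
            _ = i ! * (A (j + 1) * (CK * Ks) * ρ) * (Tm (j + 1) * ‖z‖⁻¹) ^ i := by rw [mul_one, one_mul]
            _ ≤ (j + 1)! * (A (j + 1) * (CK * Ks) * ρ) * (Tm (j + 1) * ‖z‖⁻¹) ^ i :=
                mul_le_mul_of_nonneg_right (mul_le_mul_of_nonneg_right h2 ha0) (pow_nonneg (by positivity) _)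
        have hFz : (v ∘ fold) z = u (Fold x₀ ρ x) := by rw [comp_apply, hFx, hv]
        have hPt : ∀ i ≤ j + 1, ‖iteratedFDeriv ℝ i P ((v ∘ fold) z)‖ ≤ Cmax (j + 1) := fun i hi => by
          rw [hFz]
          exact (hCf i _ (hclose _ (hFoldD x ⟨hxD, hx.2⟩) (hFoldA x hx0))).trans (hCmax_ge (j + 1) i hi)
        have hu0 : 0 ≤ ((j + 1)! : ℝ) * (A (j + 1) * (CK * Ks) * ρ) := by positivity
        have huU : ((j + 1)! : ℝ) * (A (j + 1) * (CK * Ks) * ρ) ≤ U₂ (j + 1) := by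
          refine le_trans ?_ (le_max_right _ _)
          have := hA0 (j + 1)
          calc ((j + 1)! : ℝ) * (A (j + 1) * (CK * Ks) * ρ) ≤ (j + 1)! * (A (j + 1) * (CK * c₁) * ρ) := by gcongr
            _ = (j + 1)! * A (j + 1) * (CK * c₁) * ρ := by ring
        have key := norm_iteratedFDeriv_comp_le_of_scale hs hzs hΦ hP hm (σ := (Tm (j + 1) * ‖z‖⁻¹)⁻¹) (by positivity)
          hu0 huU (hU₂1 (j + 1)) hPt hΦb
        rw [inv_inv, Nat.add_sub_cancel] at key
        -- transport back to `x`: `ᵉφ′ = (P ∘ v ∘ fold)(ρ^{-1}· − ρ^{-1}x₀)`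
        have hfes : (P ∘ u ∘ Fold x₀ ρ) = fun x' => (P ∘ (v ∘ fold)) (ρ⁻¹ • x' + (-(ρ⁻¹ • x₀))) := by
          funext x'
          simp only [comp_apply, Fold, hv]
          rw [smul_sub, sub_eq_add_neg, add_comm x₀]
        have hzx : ρ⁻¹ • x + (-(ρ⁻¹ • x₀)) = z := by rw [hz, smul_sub, sub_eq_add_neg]
        have htrans := norm_iteratedFDeriv_comp_affine_le hs (hP.comp_contDiffOn hΦ) ρ⁻¹ (-(ρ⁻¹ • x₀)) x
          (by rw [hzx]; exact hzs) (j + 1)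
        rw [hzx, ← hfes] at htrans
        -- the algebra: `ρ^{-1}(T/|z|) = T/|x − x₀|`
        have hρW : |ρ⁻¹| * (Tm (j + 1) * ‖z‖⁻¹) = Tm (j + 1) * ‖x - x₀‖⁻¹ := by
          rw [abs_of_pos (inv_pos.2 hρ), hnz, mul_inv, inv_inv]
          field_simp
        set B₂ : ℝ := (j + 1)! * Cmax (j + 1) * U₂ (j + 1) ^ j * ((j + 1)! * A (j + 1) * Tm (j + 1) ^ (j + 1)) * CK * ρ
          with hB₂
        have hB₂0 : 0 ≤ B₂ := by
          have := hA0 (j + 1); have := hCmax0 (j + 1); have := hU₂1 (j + 1); have := hTm1 (j + 1); positivity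
        have hB₂c : B₂ = c2 (j + 1) := by simp only [hB₂, hc2, Nat.add_sub_cancel]
        have hle : ‖x - x₀‖⁻¹ ^ j ≤ max ((infDist x (cubeBoundary k))⁻¹ ^ j) (‖x - x₀‖⁻¹ ^ j) := le_max_right _ _
        refine hfinal B₂ (le_add_of_nonneg_of_le (hc1_0 _) (le_of_eq hB₂c)) ?_
        calc ‖iteratedFDeriv ℝ (j + 1) (P ∘ u ∘ Fold x₀ ρ) x‖
            ≤ |ρ⁻¹| ^ (j + 1) * ‖iteratedFDeriv ℝ (j + 1) (P ∘ (v ∘ fold)) z‖ := htrans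
          _ ≤ |ρ⁻¹| ^ (j + 1) * ((j + 1)! * Cmax (j + 1) * U₂ (j + 1) ^ j * ((j + 1)! * (A (j + 1) * (CK * Ks) * ρ)) *
                (Tm (j + 1) * ‖z‖⁻¹) ^ (j + 1)) := mul_le_mul_of_nonneg_left key (by positivity)
          _ = (j + 1)! * Cmax (j + 1) * U₂ (j + 1) ^ j * ((j + 1)! * (A (j + 1) * (CK * Ks) * ρ)) *
                (|ρ⁻¹| * (Tm (j + 1) * ‖z‖⁻¹)) ^ (j + 1) := by rw [mul_pow]; ring
          _ = B₂ * ‖x - x₀‖⁻¹ ^ j * ‖x - x₀‖⁻¹ * Ks := by rw [hρW, mul_pow, pow_succ, hB₂]; ring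
          _ ≤ B₂ * max ((infDist x (cubeBoundary k))⁻¹ ^ j) (‖x - x₀‖⁻¹ ^ j) * ‖x - x₀‖⁻¹ * K := by
              have h0 : 0 ≤ B₂ * max ((infDist x (cubeBoundary k))⁻¹ ^ j) (‖x - x₀‖⁻¹ ^ j) * ‖x - x₀‖⁻¹ := by
                positivity
              calc B₂ * ‖x - x₀‖⁻¹ ^ j * ‖x - x₀‖⁻¹ * Ks
                  ≤ B₂ * max ((infDist x (cubeBoundary k))⁻¹ ^ j) (‖x - x₀‖⁻¹ ^ j) * ‖x - x₀‖⁻¹ * Ks := by gcongr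
                _ ≤ B₂ * max ((infDist x (cubeBoundary k))⁻¹ ^ j) (‖x - x₀‖⁻¹ ^ j) * ‖x - x₀‖⁻¹ * K :=
                    mul_le_mul_of_nonneg_left hKsK h0

/-! ## §4 Geometric Construction 6 for every compact `C^∞` submanifold -/

/-- **Geometric Construction 6 of [Federbush1988PhaseCellIV] §11 for every compact `C^∞` submanifold `M ⊂ R^t`** and every
centering radius `δ < ½` (the normal projection of (A.31)/(A.38) is the tree's smooth nearest-point retraction).
[cite: Federbush1988PhaseCellIV, Geometric Construction 6 (11.12)–(11.13) p. 338–339; Theorem A.4 p. 343] -/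
theorem geomConstruction6_of_submanifold {d : ℕ} {M : Set (EuclideanSpace ℝ (Fin t))} (hMc : IsCompact M)
    (hM : IsSubmanifoldOfDim d (EuclideanSpace.equiv (Fin t) ℝ '' M)) (k : ℕ) {δ : ℝ} (hδ : δ < 1 / 2) :
    GeomConstruction6 k t M δ := by
  by_cases hne : M.Nonempty
  · obtain ⟨r, hr, P, hP, hPM, hPid, hPb, -⟩ := exists_smooth_retraction_euclidean hMc hne hM
    exact geomConstruction6_of_retract hr hP hPM hPid hPb k hδ
  · -- empty target: a datum `φ′ : ∂H → ∅` forces `∂H = ∅`, i.e. `k = 0`, and then `H − x₀ = ∅`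
    intro c₁
    refine ⟨fun _ => 0, fun x₀ _ fφ _ => ?_⟩
    rcases Nat.eq_zero_or_pos k with rfl | hk
    · have hzero : ∀ y : Euc 0, y = x₀ := fun y => by
        rw [norm_eq_zero.mp (norm_eq_zero_of_dim_zero y), norm_eq_zero.mp (norm_eq_zero_of_dim_zero x₀)]
      have hempty : ∀ S : Set (Euc 0), S \ {x₀} = ∅ := fun S =>
        eq_empty_of_forall_notMem fun y hy => hy.2 (mem_singleton_iff.2 (hzero y))
      refine ⟨fun _ => 0, ?_, fun x => absurd ⟨_, (fφ x).2⟩ hne, ?_, ?_, fun m _ K _ _ x hx => ?_⟩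
      · rw [hempty]; exact mapsTo_empty _ _
      · rw [hempty]; exact continuousOn_empty _
      · rw [hempty]; exact contDiffOn_empty
      · rw [hempty] at hx; exact absurd hx (notMem_empty _)
    · haveI : NeZero k := ⟨hk.ne'⟩
      exact absurd ⟨_, (fφ ⟨0, zero_mem_cubeBoundary⟩).2⟩ hne

/-! ## §5 Print's targets: compact (gauge) groups and the spheres -/

section CompactSubgroup

variable {N : ℕ} {H : Set (Matrix (Fin N) (Fin N) ℂ)} (hHc : IsCompact H) (h1 : (1 : Matrix (Fin N) (Fin N) ℂ) ∈ H)
  (hmul : ∀ a ∈ H, ∀ b ∈ H, a * b ∈ H) (hinv : ∀ a ∈ H, ∃ b ∈ H, b * a = 1)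
include hHc h1 hmul hinv

/-- **Geometric Construction 6 for a compact matrix group `M = Ψ(H)`**, `Ψ` any real-linear identification `M_N(ℂ) ≅ R^t`.
[cite: Federbush1988PhaseCellIV, Geometric Construction 6 (11.12)–(11.13) p. 338–339; §11 p. 337 («`G`»)] -/
theorem geomConstruction6_of_isCompact_subgroup (Ψ : Matrix (Fin N) (Fin N) ℂ ≃L[ℝ] EuclideanSpace ℝ (Fin t)) (k : ℕ) {δ : ℝ}
    (hδ : δ < 1 / 2) : GeomConstruction6 k t (Ψ '' H) δ := by
  obtain ⟨𝔥, -, -, hE⟩ := isSubmanifoldOfDim_of_isCompact_subgroup hHc h1 hmul hinv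
  exact geomConstruction6_of_submanifold (hHc.image Ψ.continuous) (hE Ψ) k hδ

end CompactSubgroup

/-- **Geometric Construction 6 for `M = Ψ(ρ(G))`**, `G` any compact group, `ρ` any continuous matrix representation.
[cite: Federbush1988PhaseCellIV, Geometric Construction 6 (11.12)–(11.13) p. 338–339; §11 p. 337] -/
theorem geomConstruction6_range_of_compact {N : ℕ} {G : Type*} [Group G] [TopologicalSpace G] [CompactSpace G]
    (ρ : G →* Matrix (Fin N) (Fin N) ℂ) (hρ : Continuous ρ) (Ψ : Matrix (Fin N) (Fin N) ℂ ≃L[ℝ] EuclideanSpace ℝ (Fin t))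
    (k : ℕ) {δ : ℝ} (hδ : δ < 1 / 2) : GeomConstruction6 k t (Ψ '' Set.range ρ) δ := by
  obtain ⟨hc, h1, hmul, hinv⟩ := range_hyps ρ hρ
  exact geomConstruction6_of_isCompact_subgroup hc h1 hmul hinv Ψ k hδ

/-- **Geometric Construction 6 for the gauge group `U(N)`**, hypothesis-free (`δ < ½`). [cite: Federbush1988PhaseCellIV,
Geometric Construction 6 (11.12)–(11.13) p. 338–339; §11 p. 337] -/
theorem geomConstruction6_unitaryGroup {N : ℕ} (Ψ : Matrix (Fin N) (Fin N) ℂ ≃L[ℝ] EuclideanSpace ℝ (Fin t)) (k : ℕ) {δ : ℝ}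
    (hδ : δ < 1 / 2) : GeomConstruction6 k t (Ψ '' (Matrix.unitaryGroup (Fin N) ℂ : Set (Matrix (Fin N) (Fin N) ℂ))) δ := by
  obtain ⟨hc, h1, hmul, hinv⟩ := unitaryGroup_hyps N
  exact geomConstruction6_of_isCompact_subgroup hc h1 hmul hinv Ψ k hδ

/-- **Geometric Construction 6 for the gauge group `SU(N)`**, hypothesis-free (`δ < ½`). [cite: Federbush1988PhaseCellIV,
Geometric Construction 6 (11.12)–(11.13) p. 338–339; §11 p. 337] -/
theorem geomConstruction6_specialUnitaryGroup {N : ℕ} (Ψ : Matrix (Fin N) (Fin N) ℂ ≃L[ℝ] EuclideanSpace ℝ (Fin t)) (k : ℕ)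
    {δ : ℝ} (hδ : δ < 1 / 2) :
    GeomConstruction6 k t (Ψ '' (Matrix.specialUnitaryGroup (Fin N) ℂ : Set (Matrix (Fin N) (Fin N) ℂ))) δ := by
  obtain ⟨hc, h1, hmul, hinv⟩ := specialUnitaryGroup_hyps N
  exact geomConstruction6_of_isCompact_subgroup hc h1 hmul hinv Ψ k hδ

/-- **Geometric Construction 6 for the unit sphere `S^{t−1} ⊂ R^t`** (`SU(2) = S³`, `U(1) = S¹`), hypothesis-free (`δ < ½`).
[cite: Federbush1988PhaseCellIV, Geometric Construction 6 (11.12)–(11.13) p. 338–339; Theorem A.4 p. 343] -/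
theorem geomConstruction6_sphere (k t : ℕ) {δ : ℝ} (hδ : δ < 1 / 2) :
    GeomConstruction6 k t (sphere (0 : EuclideanSpace ℝ (Fin t)) 1) δ :=
  geomConstruction6_of_submanifold (isCompact_sphere 0 1) isSubmanifoldOfDim_euclidean_sphere k hδ

end PhaseCellIVGauge

end

end Literature.MathematicalPhysics.QuantumFieldTheory.Federbush1986
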